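import Summits.CriticalPhenomena.PercolationContinuityZ3.Theorems.PercAnnulusCrossingIICErgodicWLLN
import HarnessLib

/-!
# Patterns in the IIC: edge density `p_c`, and every local pattern of positive probability occurs infinitely often (lane RSW3, p1 gen 7)

builds on p205010 (kernel theorem, internal audit signed; external expert review pending) — used only through the (A2)□ ⇒ one-arm
quasi-multiplicativity bridge and `CSH.percolationContinuity_allDimensions` (the `p_c(ℤ^d)` statements); the `ℤ²` statements are unconditional.

Seat `prim-rsw3-p1` (gen 7).  Two corollaries of the weak law of large numbers for local patterns under Kesten's IIC measure `ν`
(`PercAnnulusCrossingIICErgodicWLLN.lean`):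

* `filter_relabel_shift_mem_edge_eq`, **`iicMeasure_tendsto_real_edgeDensity_deviation_criticalProbI` / `_Z2`** — **THE IIC HAS EDGE DENSITY
  `p_c`**: for every lattice edge `s(a,b)`, `#{x ∈ Λ(n) : s(a − x, b − x) open}/|Λ(n)| → p_c` in `ν`-probability (one-edge cylinder,
  `bondPercolation_cylinder`), although `ν ⟂ P_{p_c}`;
* `ae_infinite_setOf_mem_of_tendsto_deviation`, **`iicMeasure_ae_infinite_setOf_shift_mem_criticalProbI` / `_Z2`** — **`ν`-a.s. EVERY
  cylinder pattern `E` with `P_{p_c}(E) > 0` occurs at infinitely many sites** (`ω + x ∈ E` for infinitely many `x`): arbitrarily placed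
  vacant boxes of any fixed size, any finite open figure, … all occur (with positive density) in `ν`-almost every configuration.

Helper file for the crux `stmt-CriticalPhenomena-4575` chain; no definitions, no sorries.
References: H. Kesten, PTRF 73 (1986) 369–394, Thm. (3), (1.12)–(1.13); G. Grimmett, *Percolation* (1999), §1.3, §2.2.
-/

noncomputable section

namespace Summit.CriticalPhenomena.PercolationContinuityZ3.Theorems.Crossing

open MeasureTheory ProbabilityTheory Filter Topology
open Literature.Probability.Percolation Literature.Probability.LatticeModels
open Literature.Probability.Percolation.DCT16
open scoped ENNReal ProbabilityTheory Literature.Probability.Percolation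

variable {d : ℕ}

/-! ## The IIC has edge density `p_c` -/

open Classical in
/-- The translate of the one-edge cylinder: `ω + x ∋ s(a,b)` iff `s(a − x, b − x) ∈ ω`. [folklore] -/
theorem filter_relabel_shift_mem_edge_eq (a b : Site d) (n : ℕ) (ω : BondConfig (Site d)) :
    ((box d n).filter fun x => BondConfig.relabel (sym2Equiv (Site.shift x)) ω ∈ {ω : BondConfig (Site d) | s(a, b) ∈ ω}) =
      (box d n).filter fun x => s(a - x, b - x) ∈ ω := by
  classical
  refine Finset.filter_congr fun x _ => ?_
  show s(a, b) ∈ BondConfig.relabel (sym2Equiv (Site.shift x)) ω ↔ s(a - x, b - x) ∈ ω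
  have h' := mk_add_mem_relabel_shift_iff x ω (a - x) (b - x)
  rwa [sub_add_cancel, sub_add_cancel] at h'

open Classical in
/-- **THE IIC HAS EDGE DENSITY `p_c` (ℤ^d, under (A2)□)**: at `p_c(ℤ^d)`, `d ≥ 2`, under (A2)□ at one aspect, for every probability measure `ν`
with Kesten's IIC limit property, every lattice edge `s(a,b)` and every `η > 0`:
**`ν({ω : |#{x ∈ Λ(n) : s(a − x, b − x) open} − p_c·|Λ(n)|| ≥ η·|Λ(n)|}) → 0`** — although `ν` is carried by configurations in which the
origin lies in an infinite cluster (a `P_{p_c}`-null set), the proportion of open edges in a large box is `p_c + o(1)` in `ν`-probability.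
[cite: Kesten1986, Thm. (3), (1.12)–(1.13)] [cite: BasuSapozhnikov2017ECP, Thm. 1.1 and §1 (A2)] -/
theorem iicMeasure_tendsto_real_edgeDensity_deviation_criticalProbI (hd : 2 ≤ d) {s L : ℕ} (hs : 2 ≤ s) (hsL : s ≤ L) {ϰ : ℝ}
    (hϰ : 0 < ϰ) (hA2 : SetToSetQuasiMultAspectAt d (criticalProbI d) s L ϰ) {ν : Measure (BondConfig (Site d))}
    [IsProbabilityMeasure ν]
    (hν : ∀ (F : Finset (Sym2 (Site d))) (E : Set (BondConfig (Site d))), MeasurableSet E → DeterminedBy E ↑F →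
      Tendsto (fun n : ℕ => (bondPercolation (zdGraph d) (criticalProbI d)).real (E ∩ siteToBoundary d n) /
        oneArmProb d (criticalProbI d) n) atTop (𝓝 (ν.real E)))
    {a b : Site d} (hab : (zdGraph d).Adj a b) {η : ℝ} (hη : 0 < η) :
    Tendsto (fun n : ℕ => ν.real {ω | η * (box d n).card ≤
        |((((box d n).filter fun x => s(a - x, b - x) ∈ ω).card : ℕ) : ℝ) - (box d n).card * ((criticalProbI d : unitInterval) : ℝ)|})
      atTop (𝓝 0) := by
  classical
  have hE : DeterminedBy {ω : BondConfig (Site d) | s(a, b) ∈ ω} (↑({s(a, b)} : Finset (Sym2 (Site d))) : Set (Sym2 (Site d))) := by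
    rw [Finset.coe_singleton]
    exact determinedBy_mem _
  have h := iicMeasure_tendsto_real_density_deviation_criticalProbI hd hs hsL hϰ hA2 hν hE hη
  have hP : (bondPercolation (zdGraph d) (criticalProbI d)).real {ω : BondConfig (Site d) | s(a, b) ∈ ω} =
      ((criticalProbI d : unitInterval) : ℝ) :=
    bondPercolation_cylinder (zdGraph d) (criticalProbI d) ((SimpleGraph.mem_edgeSet _).2 hab)
  have hfun : (fun n : ℕ => ν.real {ω | η * (box d n).card ≤
      |((((box d n).filter fun x => s(a - x, b - x) ∈ ω).card : ℕ) : ℝ) - (box d n).card * ((criticalProbI d : unitInterval) : ℝ)|}) =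
      fun n : ℕ => ν.real {ω | η * (box d n).card ≤
        |((((box d n).filter fun x => BondConfig.relabel (sym2Equiv (Site.shift x)) ω ∈
            {ω : BondConfig (Site d) | s(a, b) ∈ ω}).card : ℕ) : ℝ) -
          (box d n).card * (bondPercolation (zdGraph d) (criticalProbI d)).real {ω : BondConfig (Site d) | s(a, b) ∈ ω}|} := by
    funext n
    rw [hP]
    congr 1
    ext ω
    rw [Set.mem_setOf_eq, Set.mem_setOf_eq, filter_relabel_shift_mem_edge_eq a b n ω]
  rw [hfun]
  exact h

open Classical in
/-- **THE PLANAR IIC HAS EDGE DENSITY `1/2`, unconditionally**: for every probability measure `ν` with Kesten's IIC limit property at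
`p_c(ℤ²) = 1/2`, every lattice edge `s(a,b)` and every `η > 0`: `ν({ω : |#{x ∈ Λ(n) : s(a − x, b − x) open} − p_c(ℤ²)·|Λ(n)|| ≥ η·|Λ(n)|}) → 0`.
[cite: Kesten1986, Thm. (3), (1.12)–(1.13)] -/
theorem iicMeasure_tendsto_real_edgeDensity_deviation_Z2 {ν : Measure (BondConfig (Site 2))} [IsProbabilityMeasure ν]
    (hν : ∀ (F : Finset (Sym2 (Site 2))) (E : Set (BondConfig (Site 2))), MeasurableSet E → DeterminedBy E ↑F →
      Tendsto (fun n : ℕ => (bondPercolation (zdGraph 2) (criticalProbI 2)).real (E ∩ siteToBoundary 2 n) /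
        oneArmProb 2 (criticalProbI 2) n) atTop (𝓝 (ν.real E)))
    {a b : Site 2} (hab : (zdGraph 2).Adj a b) {η : ℝ} (hη : 0 < η) :
    Tendsto (fun n : ℕ => ν.real {ω | η * (box 2 n).card ≤
        |((((box 2 n).filter fun x => s(a - x, b - x) ∈ ω).card : ℕ) : ℝ) - (box 2 n).card * ((criticalProbI 2 : unitInterval) : ℝ)|})
      atTop (𝓝 0) := by
  classical
  have hE : DeterminedBy {ω : BondConfig (Site 2) | s(a, b) ∈ ω} (↑({s(a, b)} : Finset (Sym2 (Site 2))) : Set (Sym2 (Site 2))) := by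
    rw [Finset.coe_singleton]
    exact determinedBy_mem _
  have h := iicMeasure_tendsto_real_density_deviation_Z2 hν hE hη
  have hP : (bondPercolation (zdGraph 2) (criticalProbI 2)).real {ω : BondConfig (Site 2) | s(a, b) ∈ ω} =
      ((criticalProbI 2 : unitInterval) : ℝ) :=
    bondPercolation_cylinder (zdGraph 2) (criticalProbI 2) ((SimpleGraph.mem_edgeSet _).2 hab)
  have hfun : (fun n : ℕ => ν.real {ω | η * (box 2 n).card ≤
      |((((box 2 n).filter fun x => s(a - x, b - x) ∈ ω).card : ℕ) : ℝ) - (box 2 n).card * ((criticalProbI 2 : unitInterval) : ℝ)|}) =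
      fun n : ℕ => ν.real {ω | η * (box 2 n).card ≤
        |((((box 2 n).filter fun x => BondConfig.relabel (sym2Equiv (Site.shift x)) ω ∈
            {ω : BondConfig (Site 2) | s(a, b) ∈ ω}).card : ℕ) : ℝ) -
          (box 2 n).card * (bondPercolation (zdGraph 2) (criticalProbI 2)).real {ω : BondConfig (Site 2) | s(a, b) ∈ ω}|} := by
    funext n
    rw [hP]
    congr 1
    ext ω
    rw [Set.mem_setOf_eq, Set.mem_setOf_eq, filter_relabel_shift_mem_edge_eq a b n ω]
  rw [hfun]
  exact h

/-! ## Every local pattern of positive critical probability occurs infinitely often -/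

open Classical in
/-- **From the weak law to recurrence**: if the counts `N_n(ω) = #{x ∈ Λ(n) : ω ∈ S_x}` satisfy the weak law with a limit density `P > 0`
(`ν(|N_n − |Λ(n)|P| ≥ η|Λ(n)|) → 0` for every `η > 0`), then `ν`-a.s. `ω ∈ S_x` for infinitely many `x`. [folklore] -/
theorem ae_infinite_setOf_mem_of_tendsto_deviation (hd : 1 ≤ d) {ν : Measure (BondConfig (Site d))} [IsProbabilityMeasure ν]
    (S : Site d → Set (BondConfig (Site d))) {P : ℝ} (hP : 0 < P)
    (h : ∀ η : ℝ, 0 < η → Tendsto (fun n : ℕ => ν.real {ω | η * (box d n).card ≤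
        |((((box d n).filter fun x => ω ∈ S x).card : ℕ) : ℝ) - (box d n).card * P|}) atTop (𝓝 0)) :
    ∀ᵐ ω ∂ν, {x : Site d | ω ∈ S x}.Infinite := by
  classical
  -- a.s., the counts are unbounded
  have hk : ∀ k : ℕ, ∀ᵐ ω ∂ν, ∃ n : ℕ, k ≤ ((box d n).filter fun x => ω ∈ S x).card := by
    intro k
    rw [ae_iff]
    refine (measureReal_eq_zero_iff (measure_ne_top _ _)).1 (le_antisymm (le_of_forall_pos_le_add fun ε hε => ?_) measureReal_nonneg)
    rw [zero_add]
    have hη : 0 < P / 2 := half_pos hP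
    have h1 : ∀ᶠ n : ℕ in atTop, ν.real {ω | P / 2 * (box d n).card ≤
        |((((box d n).filter fun x => ω ∈ S x).card : ℕ) : ℝ) - (box d n).card * P|} < ε :=
      (tendsto_order.1 (h (P / 2) hη)).2 ε hε
    have h2 : ∀ᶠ n : ℕ in atTop, (2 * k : ℝ) ≤ ((box d n).card : ℝ) * P :=
      ((tendsto_card_box_atTop hd).atTop_mul_const hP).eventually_ge_atTop _
    obtain ⟨n, hn1, hn2⟩ := (h1.and h2).exists
    refine le_trans (measureReal_mono (fun ω hω => ?_) (measure_ne_top _ _)) hn1.le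
    have hω' : ¬ ∃ m : ℕ, k ≤ ((box d m).filter fun x => ω ∈ S x).card := hω
    push Not at hω'
    have hlt : ((((box d n).filter fun x => ω ∈ S x).card : ℕ) : ℝ) < k := by exact_mod_cast hω' n
    show P / 2 * (box d n).card ≤ |((((box d n).filter fun x => ω ∈ S x).card : ℕ) : ℝ) - (box d n).card * P|
    rw [abs_sub_comm]
    refine le_trans ?_ (le_abs_self _)
    linarith
  rw [← ae_all_iff] at hk
  filter_upwards [hk] with ω hω hfin
  obtain ⟨n, hn⟩ := hω (hfin.toFinset.card + 1)
  have hle : ((box d n).filter fun x => ω ∈ S x).card ≤ hfin.toFinset.card :=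
    Finset.card_le_card fun x hx => hfin.mem_toFinset.2 (Finset.mem_filter.1 hx).2
  omega

open Classical in
/-- **EVERY LOCAL PATTERN OF POSITIVE CRITICAL PROBABILITY OCCURS INFINITELY OFTEN IN THE IIC (ℤ^d, under (A2)□)**: at `p_c(ℤ^d)`, `d ≥ 2`,
under (A2)□ at one aspect, for every probability measure `ν` with Kesten's IIC limit property and every cylinder event `E` with `P_{p_c}(E) > 0`:
**`ν`-a.s. `ω + x ∈ E` for infinitely many `x ∈ ℤ^d`** (e.g. arbitrarily placed vacant boxes of any fixed size, or any finite open figure,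
occur somewhere — indeed at a positive density of sites — in `ν`-almost every configuration, although `ν ⟂ P_{p_c}`).
[cite: Kesten1986, Thm. (3), (1.12)–(1.13)] [cite: BasuSapozhnikov2017ECP, Thm. 1.1 and §1 (A2)] -/
theorem iicMeasure_ae_infinite_setOf_shift_mem_criticalProbI (hd : 2 ≤ d) {s L : ℕ} (hs : 2 ≤ s) (hsL : s ≤ L) {ϰ : ℝ}
    (hϰ : 0 < ϰ) (hA2 : SetToSetQuasiMultAspectAt d (criticalProbI d) s L ϰ) {ν : Measure (BondConfig (Site d))}
    [IsProbabilityMeasure ν]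
    (hν : ∀ (F : Finset (Sym2 (Site d))) (E : Set (BondConfig (Site d))), MeasurableSet E → DeterminedBy E ↑F →
      Tendsto (fun n : ℕ => (bondPercolation (zdGraph d) (criticalProbI d)).real (E ∩ siteToBoundary d n) /
        oneArmProb d (criticalProbI d) n) atTop (𝓝 (ν.real E)))
    {F : Finset (Sym2 (Site d))} {E : Set (BondConfig (Site d))} (hE : DeterminedBy E (↑F : Set (Sym2 (Site d))))
    (hP : 0 < (bondPercolation (zdGraph d) (criticalProbI d)).real E) :
    ∀ᵐ ω ∂ν, {x : Site d | BondConfig.relabel (sym2Equiv (Site.shift x)) ω ∈ E}.Infinite :=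
  ae_infinite_setOf_mem_of_tendsto_deviation (by omega) (fun x => BondConfig.relabel (sym2Equiv (Site.shift x)) ⁻¹' E) hP
    fun _ hη => iicMeasure_tendsto_real_density_deviation_criticalProbI hd hs hsL hϰ hA2 hν hE hη

open Classical in
/-- **EVERY LOCAL PATTERN OF POSITIVE PROBABILITY OCCURS INFINITELY OFTEN IN THE PLANAR IIC, unconditionally**: for every probability measure `ν`
with Kesten's IIC limit property at `p_c(ℤ²) = 1/2` and every cylinder event `E` with `P_{1/2}(E) > 0`: `ν`-a.s. `ω + x ∈ E` for infinitely many `x`.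
[cite: Kesten1986, Thm. (3), (1.12)–(1.13)] -/
theorem iicMeasure_ae_infinite_setOf_shift_mem_Z2 {ν : Measure (BondConfig (Site 2))} [IsProbabilityMeasure ν]
    (hν : ∀ (F : Finset (Sym2 (Site 2))) (E : Set (BondConfig (Site 2))), MeasurableSet E → DeterminedBy E ↑F →
      Tendsto (fun n : ℕ => (bondPercolation (zdGraph 2) (criticalProbI 2)).real (E ∩ siteToBoundary 2 n) /
        oneArmProb 2 (criticalProbI 2) n) atTop (𝓝 (ν.real E)))
    {F : Finset (Sym2 (Site 2))} {E : Set (BondConfig (Site 2))} (hE : DeterminedBy E (↑F : Set (Sym2 (Site 2))))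
    (hP : 0 < (bondPercolation (zdGraph 2) (criticalProbI 2)).real E) :
    ∀ᵐ ω ∂ν, {x : Site 2 | BondConfig.relabel (sym2Equiv (Site.shift x)) ω ∈ E}.Infinite :=
  ae_infinite_setOf_mem_of_tendsto_deviation (d := 2) (by norm_num) (fun x => BondConfig.relabel (sym2Equiv (Site.shift x)) ⁻¹' E) hP
    fun _ hη => iicMeasure_tendsto_real_density_deviation_Z2 hν hE hη

end Summit.CriticalPhenomena.PercolationContinuityZ3.Theorems.Crossing

end
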